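import Literature.NumberTheory.EllipticCurves.UniversalOrdinaryRing
import Literature.NumberTheory.EllipticCurves.FormalGroupMultiplicationUniversalProofs
import Literature.RingTheory.HenselLemma.WeierstrassPreparation
import HarnessLib

/-!
# The canonical subgroup of the universal ordinary curve: `[p]_𝓔(t) = d(t)·v(t)` with `d`
# distinguished of degree `p` (Lubin; the formal-group side of Blakestad–Grant's Prop. 7 / Lemma 12)

Trunk T-NT-EC (Literature/NumberTheory/EllipticCurves). Over Blakestad–Grant's ring `R̂`
(`UniversalOrdinaryRing.lean`: `completeRing p`, the universal ordinary curve `𝓔 = universalCurve p`,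
`p ≥ 5`) the multiplication-by-`p` series `[p]_𝓔(t) ∈ R̂⟦t⟧` (`formalMul`) has all coefficients
below degree `p` in `pR̂` (AEC IV.4.4, `coeff_formalMul_prime_mem_span` of
`FormalGroupMultiplicationUniversalProofs.lean`) and its `tᵖ`-coefficient is a UNIT, being
`≡ A_p ≡ H (mod p)` (Katz–Mazur 12.4.2, `coeff_prime_formalMul_sub_hasseCoeff_mem_span`, and
`isUnit_hasseCoeff_universalCurve`). Hence `[p]_𝓔` is a Weierstrass divisor at `(p)` of
Weierstrass degree `p`, and by the Weierstrass preparation theorem at the ideal `(p)` of the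
(non-local) complete ring `R̂` (`Literature.RingTheory.HenselLemma.existsUnique_isWeierstrassFactorizationAt`)

  **`[p]_𝓔(t) = d(t) · v(t)`, `d ∈ R̂[t]` monic of degree `p` with lower coefficients in `pR̂`,
  `v ∈ R̂⟦t⟧ˣ`, uniquely** (`existsUnique_formalMul_prime_factorization`).

The zeros of `d` (in the open unit disc over any `p`-adically complete field over `R̂`) are the
`t`-coordinates of the `p`-torsion of the formal group `Ê`, i.e. of the CANONICAL SUBGROUP of `𝓔`
(Lubin 1967: finite subgroups of a formal group over a `p`-adic ring ↔ Weierstrass polynomials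
dividing `[p]`); this is the formal-group counterpart of the factor `φ_ψ(x)` of the `p`-division
polynomial in Blakestad–Grant's Prop. 7 (eq. (4)) and of the distinguished factor of `t'` in their
Lemma 12.

* `coeff_formalMul_prime_mem_of_lt`, `isUnit_coeff_prime_formalMul`,
  `isWeierstrassDivisorAt_formalMul_prime`, `existsUnique_formalMul_prime_factorization`,
  `natDegree_eq_of_isWeierstrassFactorizationAt_formalMul_prime`.

## Sources

* J. Lubin, *Finite subgroups and isogenies of one-parameter formal Lie groups*, Ann. of Math. 85
  (1967), §1 (Thm. 1.4: subgroups as Weierstrass polynomials). [folklore]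
* C. Blakestad, D. Grant, J. Number Theory 249 (2023), Prop. 7 (eq. (4), `φ_ψ ≡ H (mod p)`) and
  Lemma 12 (Weierstrass preparation of `t'` over `R̂`). [BlakestadGrant2023]
* J. H. Silverman, *AEC* 2nd ed. (2009), IV.4.4; N. M. Katz, B. Mazur, *Arithmetic Moduli of
  Elliptic Curves* (1985), 12.4.2. [SilvermanAEC2009]

Pure proof file: no definitions, no named facts.
-/

noncomputable section

namespace Literature.NumberTheory.EllipticCurves.UniversalOrdinary

open Literature.RingTheory.AdicTopology Literature.RingTheory.HenselLemma

variable (p : ℕ) [Fact p.Prime]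

/-- The low coefficients of `[p]_𝓔` lie in `(p)`: `[tᵏ][p] ∈ pR̂` for `k < p`. [Silverman AEC IV.4.4]
[cite: SilvermanAEC2009, IV.4.4] -/
theorem coeff_formalMul_prime_mem_of_lt {k : ℕ} (hk : k < p) :
    PowerSeries.coeff k ((universalCurve p).formalMul p) ∈ Ideal.span {(p : completeRing p)} := by
  rcases Nat.eq_zero_or_pos k with rfl | hk0
  · rw [PowerSeries.coeff_zero_eq_constantCoeff_apply, WeierstrassCurve.constantCoeff_formalMul]
    exact Ideal.zero_mem _
  · exact (universalCurve p).coeff_formalMul_prime_mem_span p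
      (fun h => absurd (Nat.le_of_dvd hk0 h) (not_le.mpr hk))

/-- **`[tᵖ][p]_𝓔` is a unit of `R̂`** (`p ≥ 5`): it is `≡ A_p ≡ H (mod p)`, and `H ∈ R̂ˣ`.
[Blakestad–Grant 2023, §2.1 (`H` invertible in `R̂`); Katz–Mazur 12.4.2] [cite: BlakestadGrant2023, §2.1] -/
theorem isUnit_coeff_prime_formalMul (hp5 : 5 ≤ p) :
    IsUnit (PowerSeries.coeff p ((universalCurve p).formalMul p)) := by
  have hmem := (universalCurve p).coeff_prime_formalMul_sub_hasseCoeff_mem_span p (by omega)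
  refine isUnit_of_isUnit_mk (Ideal.span {(p : completeRing p)}) ?_
  rw [(Ideal.Quotient.eq).mpr hmem]
  exact (isUnit_hasseCoeff_universalCurve p).map _

/-- **`[p]_𝓔(t)` is a Weierstrass divisor at `(p)` of Weierstrass degree `p`** (`p ≥ 5`).
[Silverman AEC IV.4.4; Lubin 1967 (finite subgroups of formal groups)] [folklore] -/
theorem isWeierstrassDivisorAt_formalMul_prime (hp5 : 5 ≤ p) :
    ((universalCurve p).formalMul p).IsWeierstrassDivisorAt (Ideal.span {(p : completeRing p)}) ∧
      (((universalCurve p).formalMul p).map (Ideal.Quotient.mk (Ideal.span {(p : completeRing p)}))).order.toNat = p :=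
  isWeierstrassDivisorAt_of_coeff_mem (fun _ hk => coeff_formalMul_prime_mem_of_lt p hk)
    (isUnit_coeff_prime_formalMul p hp5) (span_natCast_isPrime_completeRing p hp5).ne_top

/-- **The canonical subgroup of the universal ordinary curve as a Weierstrass polynomial**
(`p ≥ 5`): `[p]_𝓔(t) = d(t)·v(t)` in `R̂⟦t⟧` for a UNIQUE pair with `d ∈ R̂[t]` distinguished at
`(p)` (monic, lower coefficients in `pR̂`) of degree `p` and `v ∈ R̂⟦t⟧ˣ`; the roots of `d` in the
open unit disc (over any `p`-adic field over `R̂`) are the `t`-coordinates of the `p`-torsion of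
`Ê`, i.e. of the canonical subgroup. [Lubin 1967, Thm. 1.4 (finite subgroups ↔ Weierstrass
polynomials); Blakestad–Grant 2023, Lemma 12 (the analogous factorisation of `t'`)] [folklore] -/
theorem existsUnique_formalMul_prime_factorization (hp5 : 5 ≤ p) :
    ∃! dv : Polynomial (completeRing p) × PowerSeries (completeRing p),
      ((universalCurve p).formalMul p).IsWeierstrassFactorizationAt dv.1 dv.2
        (Ideal.span {(p : completeRing p)}) :=
  existsUnique_isWeierstrassFactorizationAt (isWeierstrassDivisorAt_formalMul_prime p hp5).1
    (span_natCast_isPrime_completeRing p hp5).ne_top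

/-- The distinguished factor of `[p]_𝓔` has degree `p`. [folklore] -/
theorem natDegree_eq_of_isWeierstrassFactorizationAt_formalMul_prime (hp5 : 5 ≤ p)
    {d : Polynomial (completeRing p)} {v : PowerSeries (completeRing p)}
    (h : ((universalCurve p).formalMul p).IsWeierstrassFactorizationAt d v (Ideal.span {(p : completeRing p)})) :
    d.natDegree = p := by
  rw [h.natDegree_eq_toNat_order_map_of_ne_top (span_natCast_isPrime_completeRing p hp5).ne_top,
    (isWeierstrassDivisorAt_formalMul_prime p hp5).2]

end Literature.NumberTheory.EllipticCurves.UniversalOrdinary
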